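import Mathlib.Analysis.Complex.ExponentialBounds
import Summits.Ventures.WeilGRH.DualTrigLatticeCertMod13Class5OneP
import Summits.Ventures.WeilGRH.DualTrigFamilyValues
import Literature.NumberTheory.LFunctions.WeilExplicitDirichletConj
import HarnessLib

/-!
# Format D-K v3 (multi-lattice) instance at `t = 1 (exact window)`: Weil positivity for the key class of `13.5` / `13.8` (every modulus `≥ 13`) — assembly and theorems
(FLAT layout: the certificate literal `cert_q13_c5_w1`, its frame parts and the cell ranges are in `DualTrigLatticeCertMod13Class5OneA.lean`, `DualTrigLatticeCertMod13Class5OneB.lean`, `DualTrigLatticeCertMod13Class5OneC.lean`, `DualTrigLatticeCertMod13Class5OneD.lean`, `DualTrigLatticeCertMod13Class5OneE.lean`, `DualTrigLatticeCertMod13Class5OneF.lean`, `DualTrigLatticeCertMod13Class5OneG.lean`, `DualTrigLatticeCertMod13Class5OneH.lean`, `DualTrigLatticeCertMod13Class5OneI.lean`, `DualTrigLatticeCertMod13Class5OneJ.lean`, `DualTrigLatticeCertMod13Class5OneK.lean`, `DualTrigLatticeCertMod13Class5OneL.lean`; parts B… carry their own copies of the literal, identified with `cert_q13_c5_w1` here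 by `rfl`.)

Cell `rh-explicit`, WEIL TRACK — GRH ARM, route B (weil-grh-3, gen17): the rung `t = 1 EXACTLY (window `N = 7`, `e² ≤ 8`, atoms admissible from frequency `2`)` (window `N = 7`) for the key class
of census class `13.5` (conjugate `13.8`): parity 1, `χ(2) = e(-1/4)`, `χ(3) = e(0/1)`, `χ(4) = e(1/2)`, `χ(5) = e(-1/4)`, `χ(7) = e(1/4)` — an odd complex class below the arm's uniform `t = 1`
conductor floors (every χ mod `q ≥ 78`; every odd χ mod `q ≥ 31`; `2 ∣ q ≥ 14`, `3 ∣ q ≥ 18`, `6 ∣ q ≥ 12` for odd χ: `UniformConductorFloor*`, `DualTrigUniversal*`).  The certificate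
`cert_q13_c5_w1` is a format-D-K v3.2 (fast cell checker) (MULTI-LATTICE) dual multiplier certificate (`DualTrigKernelLatticeDefs.lean`, soundness `DualTrigKernelLattice*.lean`): besides the base lattice `ω = log 2 /
12` (105 atoms) it carries atoms on the lattices `log 3 / 3` (22 atoms, `mT_3 = -1.018`); `log 5 / 4` (19 atoms, `mT_5 = -0.974`); `log 7 / 5` (22 atoms, `mT_7 = -1.033`); `log 2981 / 4` (0
atoms, `mT_2981 = 0.000`), so that the window terms `n = 3, 5, 7` are commensurable with SOME lattice and the tail inequality `tailOK3` loses no amplitude (`B_rest = 0`; the single-lattice doors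
lose `B_inc = 4.18` and need `|τ| ≲ 110–320`); 168 atoms in all (each `k ω_p ≥ log 8`, i.e. `8^D_p ≤ p^k` in ℕ), LP margin `μ = 0.0488` (kit LP `dkcert3.py`); 592 cells in 5 block(s) covering
`|τ| ≤ 100.1` on both sides, base period bound `mT = -2.1038`.  The frame parts (`constsOK`, `valsOK`, `valsNodup`, `atomsOK`, `blocksOK` through the phase tables, `latsOK` = lattice
admissibility and the claimed ratio enclosures `r_p = ω_p/ω` against the engine, `latCoverOK`, `tailOK3`) and the cell ranges (`blockRangeOKP` = the full inequality on all 173 terms plus the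
per-lattice period duties through `DKCert.cellLoT`, each ≤ 8 cells) are evaluated by `decide +kernel`; `DKCert3.weilPositivityOnChar_family_of_checkP` gives the rung for EVERY modulus `q ≥
c.base.q`, `weilPositivityOnChar_inv_iff` the conjugate class, and `WeilPositivityOnChar.mono` (`1 ≤ (log 8)/2`) the `t = 1` corollaries. Headline:
`weilPositivityOnChar_one_of_ge13_odd_chi2_I_chi3_one` / `weilPositivityOnChar_one_of_ge13_odd_chi2_I_chi3_one_conj`: `WeilPositivityOnChar χ (1)` for EVERY modulus `q ≥ 13` and every Dirichlet
character `χ` mod `q` with these data, `weilPositivityOnChar_one_of_ge13_odd_chi2_I_chi3_one[_conj]` the same on `[−1, 1]`, and `weilPositivityOnChar_mod13_class5_one` / `_conj` (at `t = 1`) for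
the two characters `13.5`, `13.8` mod 13. Honest scope: a THEOREM for these characters and test functions supported in `[−1, 1]` (and, by monotonicity, on `[−1, 1]`); nothing beyond this window.
No named facts, no `sorry`; axioms standard.  (The kernel assembly `cert_q13_c5_w1_cellsOKP` / `…_latsOKw` lives in part P, `DualTrigLatticeCertMod13Class5OneP`, split off by weil-grh-1 gen12 to meet the 400-line rule.)
-/

set_option Elab.async false
set_option maxHeartbeats 0
set_option maxRecDepth 100000

namespace Summit.Ventures.WeilGRH

open Literature.NumberTheory.LFunctions Literature.Analysis.ValidatedNumerics.NumericsMP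

/-- The window data as a list literal. [folklore] -/
theorem cert_q13_c5_w1_vals_eq : cert_q13_c5_w1.base.vals = [⟨2, 2, 1, -1, 4, 707106781186, 707106781187, 1000000000000⟩, ⟨3, 3, 1, 0, 1, 577350269189, 577350269190, 1000000000000⟩, ⟨4, 2, 2, 1, 2, 500000000000, 500000000001, 1000000000000⟩, ⟨5, 5, 1, -1, 4, 447213595499, 447213595500, 1000000000000⟩, ⟨7, 7, 1, 1, 4, 377964473009, 377964473010, 1000000000000⟩] := rfl

/-- **Key class of `13.5` at `t = 1` EXACTLY, every modulus `q ≥ 13`**: for every Dirichlet character `χ` mod `q` of parity 1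
with `χ(2) = e(-1/4)`, `χ(3) = e(0/1)`, `χ(5) = e(-1/4)`, `χ(7) = e(1/4)` and every smooth `g` supported in `[−1, 1]`,
`Re W_χ(g ⋆ g̃) ≥ 0`.  Kernel-checked format-D-K v3.2 (fast cell checker) WINDOW certificate (atoms from frequency `2`, `e² ≤ 8`) + `DKCert3.weilPositivityOnChar_window_family_of_partsP`. [folklore] -/
theorem weilPositivityOnChar_one_of_ge13_odd_chi2_I_chi3_one {q : ℕ} (hq : 13 ≤ q) (χ : DirichletCharacter ℂ q) (hpar : charParity χ = 1)
    (hχ2 : χ 2 = Complex.exp (2 * Real.pi * Complex.I * (-1 / 4))) (hχ3 : χ 3 = Complex.exp (2 * Real.pi * Complex.I * (0 / 1))) (hχ5 : χ 5 = Complex.exp (2 * Real.pi * Complex.I * (-1 / 4))) (hχ7 : χ 7 = Complex.exp (2 * Real.pi * Complex.I * (1 / 4))) : WeilPositivityOnChar χ 1 := by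
  have hexp : Real.exp (2 * (((1 : ℕ) : ℝ) / ((1 : ℕ) : ℝ))) ≤ ((cert_q13_c5_w1.base.N : ℕ) : ℝ) + 1 := by
    rw [show cert_q13_c5_w1.base.N = 7 from rfl]
    have h := Real.exp_one_lt_d9
    have e : Real.exp (2 * (((1 : ℕ) : ℝ) / ((1 : ℕ) : ℝ))) = Real.exp 1 ^ 2 := by
      rw [sq, ← Real.exp_add]; norm_num
    rw [e]; push_cast
    nlinarith [Real.exp_pos (1 : ℝ)]
  have h := DKCert3.weilPositivityOnChar_window_family_of_partsP cert_q13_c5_w1_constsOK cert_q13_c5_w1_valsOK cert_q13_c5_w1_valsNodup cert_q13_c5_w1_blocksOK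
    (tn := 1) (td := 1) (by norm_num) cert_q13_c5_w1_latsOKw cert_q13_c5_w1_latCoverOK cert_q13_c5_w1_tailOK3 cert_q13_c5_w1_cellsOKP cert_q13_c5_w1_windowOK hexp
    hq (by omega) χ hpar ?_ ?_
  · rw [show ((((1 : ℕ) : ℝ) / ((1 : ℕ) : ℝ)) : ℝ) = 1 by norm_num] at h
    exact h
  · intro val hval
    rw [cert_q13_c5_w1_vals_eq] at hval
    simp only [List.mem_cons, List.mem_nil_iff, or_false] at hval
    rcases hval with rfl | rfl | rfl | rfl | rfl
    · change χ ((2 : ℕ) : ZMod q) = _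
      rw [Nat.cast_ofNat, hχ2, DKCert.valZ_eq_expPhase, Complex.exp_eq_exp_iff_exists_int]
      exact ⟨0, by push_cast; ring⟩
    · change χ ((3 : ℕ) : ZMod q) = _
      rw [Nat.cast_ofNat, hχ3, DKCert.valZ_eq_expPhase, Complex.exp_eq_exp_iff_exists_int]
      exact ⟨0, by push_cast; ring⟩
    · change χ ((4 : ℕ) : ZMod q) = _
      rw [Nat.cast_ofNat, show (4 : ZMod q) = 2 ^ 2 by norm_num, map_pow, hχ2, ← Complex.exp_nat_mul, DKCert.valZ_eq_expPhase,
        Complex.exp_eq_exp_iff_exists_int]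
      exact ⟨-1, by push_cast; ring⟩
    · change χ ((5 : ℕ) : ZMod q) = _
      rw [Nat.cast_ofNat, hχ5, DKCert.valZ_eq_expPhase, Complex.exp_eq_exp_iff_exists_int]
      exact ⟨0, by push_cast; ring⟩
    · change χ ((7 : ℕ) : ZMod q) = _
      rw [Nat.cast_ofNat, hχ7, DKCert.valZ_eq_expPhase, Complex.exp_eq_exp_iff_exists_int]
      exact ⟨0, by push_cast; ring⟩
  · exact DKCert.hχ0_of_coprime_window χ (by
      intro n h2 hn
      rw [show cert_q13_c5_w1.base.N = 7 from rfl] at hn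
      rw [show cert_q13_c5_w1.base.q = 13 from rfl]
      interval_cases n
      all_goals decide)

/-- **Key class of `13.8` (the conjugate class) at `t = 1`, every modulus `q ≥ 13`**: from `weilPositivityOnChar_one_of_ge13_odd_chi2_I_chi3_one` through
`χ ↦ χ⁻¹` (`weilPositivityOnChar_inv_iff`: conjugate characters share every rung). [folklore] -/
theorem weilPositivityOnChar_one_of_ge13_odd_chi2_I_chi3_one_conj {q : ℕ} (hq : 13 ≤ q) (χ : DirichletCharacter ℂ q) (hpar : charParity χ = 1)
    (hχ2 : χ 2 = Complex.exp (2 * Real.pi * Complex.I * (1 / 4))) (hχ3 : χ 3 = Complex.exp (2 * Real.pi * Complex.I * (0 / 1))) (hχ5 : χ 5 = Complex.exp (2 * Real.pi * Complex.I * (1 / 4))) (hχ7 : χ 7 = Complex.exp (2 * Real.pi * Complex.I * (-1 / 4))) : WeilPositivityOnChar χ 1 := by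
  haveI : NeZero q := ⟨by omega⟩
  have hpar' : charParity χ⁻¹ = 1 := by rw [charParity_inv]; exact hpar
  have h2' : χ⁻¹ 2 = Complex.exp (2 * Real.pi * Complex.I * (-1 / 4)) := by
    rw [MulChar.inv_apply_eq_inv', hχ2, ← Complex.exp_neg]
    congr 1
    ring
  have h3' : χ⁻¹ 3 = Complex.exp (2 * Real.pi * Complex.I * (0 / 1)) := by
    rw [MulChar.inv_apply_eq_inv', hχ3, ← Complex.exp_neg]
    congr 1
    ring
  have h5' : χ⁻¹ 5 = Complex.exp (2 * Real.pi * Complex.I * (-1 / 4)) := by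
    rw [MulChar.inv_apply_eq_inv', hχ5, ← Complex.exp_neg]
    congr 1
    ring
  have h7' : χ⁻¹ 7 = Complex.exp (2 * Real.pi * Complex.I * (1 / 4)) := by
    rw [MulChar.inv_apply_eq_inv', hχ7, ← Complex.exp_neg]
    congr 1
    ring
  exact (weilPositivityOnChar_inv_iff χ (1)).1 (weilPositivityOnChar_one_of_ge13_odd_chi2_I_chi3_one hq χ⁻¹ hpar' h2' h3' h5' h7')

/-- **Census class `13.5` mod 13 at `t = 1`**: every Dirichlet character `χ` mod 13 with `χ(2) = e(-1/4)`
(then `χ(−1) = χ(2)^6 = -1`, `χ(3) = χ(2)^4 = e(0/1)`, `χ(5) = χ(2)^9 = e(-1/4)`, `χ(7) = χ(2)^11 = e(1/4)`; this is the census character `13.5`) satisfies Weil positivity on `[−1, 1]`: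
`Re W_χ(g ⋆ g̃) ≥ 0` for every smooth `g` supported there. [folklore] -/
theorem weilPositivityOnChar_mod13_class5_one (χ : DirichletCharacter ℂ 13)
    (hχ2 : χ 2 = Complex.exp (2 * Real.pi * Complex.I * (-1 / 4))) : WeilPositivityOnChar χ 1 := by
  have hm1 : χ (-1) = -1 := by
    rw [show (-1 : ZMod 13) = 2 ^ 6 by decide, map_pow, hχ2, ← Complex.exp_nat_mul]
    conv_rhs => rw [DKCert.neg_one_eq_expPhase]
    rw [Complex.exp_eq_exp_iff_exists_int]
    exact ⟨-2, by push_cast; ring⟩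
  have hpar : charParity χ = 1 := charParity_of_odd hm1
  have h3 : χ 3 = Complex.exp (2 * Real.pi * Complex.I * (0 / 1)) := by
    rw [show (3 : ZMod 13) = 2 ^ 4 by decide, map_pow, hχ2, ← Complex.exp_nat_mul, Complex.exp_eq_exp_iff_exists_int]
    exact ⟨-1, by push_cast; ring⟩
  have h5 : χ 5 = Complex.exp (2 * Real.pi * Complex.I * (-1 / 4)) := by
    rw [show (5 : ZMod 13) = 2 ^ 9 by decide, map_pow, hχ2, ← Complex.exp_nat_mul, Complex.exp_eq_exp_iff_exists_int]
    exact ⟨-2, by push_cast; ring⟩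
  have h7 : χ 7 = Complex.exp (2 * Real.pi * Complex.I * (1 / 4)) := by
    rw [show (7 : ZMod 13) = 2 ^ 11 by decide, map_pow, hχ2, ← Complex.exp_nat_mul, Complex.exp_eq_exp_iff_exists_int]
    exact ⟨-3, by push_cast; ring⟩
  exact weilPositivityOnChar_one_of_ge13_odd_chi2_I_chi3_one (le_refl 13) χ hpar hχ2 h3 h5 h7

/-- **Census class `13.8` mod 13 at `t = 1`**: every Dirichlet character `χ` mod 13 with `χ(2) = e(1/4)`
(then `χ(−1) = χ(2)^6 = -1`, `χ(3) = χ(2)^4 = e(0/1)`, `χ(5) = χ(2)^9 = e(1/4)`, `χ(7) = χ(2)^11 = e(-1/4)`; this is the census character `13.8`) satisfies Weil positivity on `[−1, 1]`: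
`Re W_χ(g ⋆ g̃) ≥ 0` for every smooth `g` supported there. [folklore] -/
theorem weilPositivityOnChar_mod13_class5_one_conj (χ : DirichletCharacter ℂ 13)
    (hχ2 : χ 2 = Complex.exp (2 * Real.pi * Complex.I * (1 / 4))) : WeilPositivityOnChar χ 1 := by
  have hm1 : χ (-1) = -1 := by
    rw [show (-1 : ZMod 13) = 2 ^ 6 by decide, map_pow, hχ2, ← Complex.exp_nat_mul]
    conv_rhs => rw [DKCert.neg_one_eq_expPhase]
    rw [Complex.exp_eq_exp_iff_exists_int]
    exact ⟨1, by push_cast; ring⟩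
  have hpar : charParity χ = 1 := charParity_of_odd hm1
  have h3 : χ 3 = Complex.exp (2 * Real.pi * Complex.I * (0 / 1)) := by
    rw [show (3 : ZMod 13) = 2 ^ 4 by decide, map_pow, hχ2, ← Complex.exp_nat_mul, Complex.exp_eq_exp_iff_exists_int]
    exact ⟨1, by push_cast; ring⟩
  have h5 : χ 5 = Complex.exp (2 * Real.pi * Complex.I * (1 / 4)) := by
    rw [show (5 : ZMod 13) = 2 ^ 9 by decide, map_pow, hχ2, ← Complex.exp_nat_mul, Complex.exp_eq_exp_iff_exists_int]
    exact ⟨2, by push_cast; ring⟩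
  have h7 : χ 7 = Complex.exp (2 * Real.pi * Complex.I * (-1 / 4)) := by
    rw [show (7 : ZMod 13) = 2 ^ 11 by decide, map_pow, hχ2, ← Complex.exp_nat_mul, Complex.exp_eq_exp_iff_exists_int]
    exact ⟨3, by push_cast; ring⟩
  exact weilPositivityOnChar_one_of_ge13_odd_chi2_I_chi3_one_conj (le_refl 13) χ hpar hχ2 h3 h5 h7

end Summit.Ventures.WeilGRH
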